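import Summits.BirchSwinnertonDyer.Rank1Residual.P2.KrizLiStarFields
import Summits.BirchSwinnertonDyer.Rank1Residual.P2.KrizLiTwistMinimalModelsGoodBases
import Summits.BirchSwinnertonDyer.Rank1Residual.P2.CornerFTwoCertificatesKrizLiBases
import Literature.NumberTheory.EllipticCurves.SzpiroLocalDataProofs
import Literature.NumberTheory.EllipticCurves.BSDConductor
import HarnessLib

/-!
# Cell `bsd-print-cf2` (D-0131 (2) PRINT TIER, leaf CornerF @ `p = 2`), seat ty3 — display glue for the
# Kriz–Li twist-family certificate records at the ninth (★)-CERTIFIED base `4563b1` (the `ℚ`-isogeny class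
# of the Sylvester cube-sum curve `x³ + y³ = 13`; `K = ℚ(√−23)`): the `13`-part of the conductor in the
# kernel, the family BY NAME in the uniform shape of the other bases, and every CERTIFIED record a member

HONEST FRAMING (cell `bsd-print-cf2`, run/shared/lean/pub/bsd-print-cf2/; verbatim): PARTITION currency
only — the leaf counts when its class theorem is in the kernel BY NAME; every imported theorem carries its
printed hypotheses verbatim. The leaf is OPEN AS A CLASS; nothing class-wide is closed here; theorems
only, no definition, no named fact. Companion of `P2/CornerFTwoCertificatesKrizLiBases.lean` (the seven
other (★)-certified `j = 0` bases) for the NINTH base of the cell's Kriz–Li (★)-door (aside 21366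
`InertKrizLiStarDoorOfFactsPlus`, p3's `bsdp_two_of_isIsogenousToKrizLiTwistOfSmallCMBase`): Cremona's
`4563b1 = [0,0,1,0,42]` (`y² + y = x³ + 42 ≅ Y² = X³ + 2⁴·13²`, `Δ = −3³·13⁴`, `j = 0`, GOOD supersingular at
`2`, the `3`-isogeny image of `x³ + y³ = 13` — p3's `P2/KrizLiCubeSumThirteenCurve.lean`, ty2 g6's
`P2/KrizLiStarFields.lean` §2). At this base Assumption (★) is NOT printed (Kriz–Li Table 1 stops before
`N = 4563`): it is the lit seat's exact certificate over `ℚ(√D)`, `D ∈ {−23, −95, −191, −263, −287, −311,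
−407, −503, −599, −623}` (ty3's `RecordsStarJZeroGood.lean`), and enters every theorem below as the
DISPLAYED hypothesis `hSD : HasKrizLiStarDatum curve4563b1 (sqrtField D)` — currency
LITERAL-by-name((★)-certificate).

WHAT IS NEW HERE (§0, a kernel computation, not a beyond-print theorem): p3 proved `N(4563b1) ∣ 3³·13²` and
therefore had to carry the sign condition `χ_d(−N) = 1` as the extra binder `(d/13) = 1` (if the kernel does not
know that `13²` divides `N` EXACTLY, `(N/d)` could be `(13/d)`); ty2 g6 kept that binder. §0 settles it: the
globally minimal equation has `13 ∣ Δ`, `13 ∣ c₄ = 0`, so the reduction at `13` is ADDITIVE (Silverman VII.5.1 (c),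
tree `hasAdditiveReductionAt_iff_of_isMinimalAt`), hence `f₁₃ = 2` (ATAEC IV.10.2 (b), tree
`conductorExponent_eq_two_of_five_le_of_isElliptic`), `N = 3^i·13²`, and `sgn(d)·(N/d) = (3/d)^i·(13/d)² = 1`
for EVERY positive `d ≡ 1 (mod 12)` prime to `13` — and `13 ∤ d` is automatic for `d ∈ 𝒩(4563b1, K)` (a silent
prime does not divide `2N ∋ 13`). So (§1–§2) the `4563b1` family is stated in EXACTLY the uniform shape of the
other good bases — binders `hd : d ∈ 𝒩`, `0 < d`, `d ≡ 1 (mod 12)` — both for isogeny classes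
(`bsdp_two_of_isIsogenous_twist_of_inN_curve4563b1_sqrtField`) and ON THE NOSE for the twist model
`E_k : y² + y = x³ + k`, `4k + 1 = 13²·d³` (ty2 g5's `analyticRank_eq_one_and_bsdp_two_twistModel_curve4563b1`):
`E_k` globally minimal, `ord_{s=1} L(E_k, s) = 1 ∧ BSD(E_k, 2)`. §3 is the record glue: for a record `r` of a
`KLCertified` list (schema `KrizLiSchema.lean`) with base data `(d_K, c, badPrimes) = (−23, −2704, [2,3,13])`
(`a_ℓ(4563b1)` odd ⟺ `#{x ∈ 𝔽_ℓ : x³ = −2704}` even, p3's `odd_frobeniusTrace_curve4563b1_iff`), the recheck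
decided `0 < d ≡ 1 (mod 12)`, `d` square-free, every prime of `d` silent; ty2 g6's `inN_curve4563b1_of_discr_eq`
turns that into `d ∈ 𝒩(4563b1, ℚ(√−23))`, and §2 concludes. Granted throughout: p3's seven binders
`hKL h33 hS31 hBF hmod hGZK hCassels` (Kriz–Li Thm 5.1 (2) / Thm 4.3, Creutz–Miller + Miller–Stoll `N < 5000`,
Burungale–Flach, modularity, GZK, Cassels) and `hSD`. beyond-print theorem: NO (display glue + one local
conductor exponent). [cite: KrizLi2019, Thm. 1.12 (FMS Thm. 5.1 (2)), Thm. 4.3, Def. 4.1, §6 Ex. 6.2]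
[cite: Cremona1997, Table 1 (curve 4563b1)]

References: [KrizLi2019] Thm 1.12/5.1 (2), Thm 4.3, Def 4.1, §6; [Cremona1997] Table 1 (4563b1);
[SilvermanAEC2009] VII.5 Prop. 5.1; [Silverman1994] IV.10.2, IV.10.4; [CreutzMiller2012] Thm 1.1;
[BurungaleFlach2024] Cor 2; [MilneADT2006] Thm I.7.3; [Miller2011LMS] Def 1.1; tree `P2/KrizLiCubeSumThirteen*`
(p3), `P2/KrizLiStarFields`, `P2/KrizLiTwistMinimalModelsGoodBases` (ty2), `…/CornerFTwoCertificates/KrizLiSchema`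
(ty3); HOME/lit/census-g5/STARCERT-TABLE.md.
-/

noncomputable section

open scoped Classical

open WeierstrassCurve NumberField IsDedekindDomain Rat.HeightOneSpectrum Literature.NumberTheory.EllipticCurves
  Literature.NumberTheory.EllipticCurves.Rank1Residual
  Literature.NumberTheory.EllipticCurves.ModularForms
  Literature.NumberTheory.EllipticCurves.Rank1Residual.CornerFTwoCertificates
  Summit.BirchSwinnertonDyer.Rank1Residual

set_option autoImplicit false

namespace Summit.BirchSwinnertonDyer.Rank1Residual.P2

/-! ## §0 The `13`-part of `N(4563b1)` IS `13²` (additive reduction at `13`, `f₁₃ = 2`), hence `χ_d(−N) = 1`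
for every positive `d ≡ 1 (mod 12)` prime to `13` -/

/-- **`4563b1 : y² + y = x³ + 42` has additive reduction at `13`** (`Δ = −3³·13⁴`, `c₄ = 0`; the equation is
minimal at `13` since `13¹² ∤ Δ`, so VII.5.1 (c) reads the type off `13 ∣ Δ`, `13 ∣ c₄`).
[cite: SilvermanAEC2009, VII.5 Prop. 5.1 (c) and VII.1 Remark 1.1] [cite: Cremona1997, Table 1 (curve 4563b1)] -/
theorem hasAdditiveReductionAt_curve4563b1_thirteen (v : HeightOneSpectrum ℤ) (hv : natGenerator v = 13) :
    curve4563b1.HasAdditiveReductionAt v := by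
  have hmin : curve4563b1.IsMinimalAt v := by
    have h := isMinimalAt_baseChange_int_of_not_pow_dvd_Δ (v := v) (W₀ := curve4563b1Int)
      (by rw [hv, curve4563b1Int_Δ]; decide)
    rwa [curve4563b1Int_baseChange] at h
  rw [hasAdditiveReductionAt_iff_of_isMinimalAt hmin, curve4563b1_Δ, curve4563b1_c₄, map_zero,
    show (-771147 : ℚ) = ((-771147 : ℤ) : ℚ) by norm_num,
    Literature.NumberTheory.EllipticCurves.Rat.valuation_intCast_lt_one_iff, hv]
  exact ⟨by norm_num, zero_lt_one⟩

/-- **`f₁₃(4563b1) = 2`** (additive reduction at a prime `≥ 5` is tame: Silverman ATAEC IV.10.2 (b), tree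
theorem `conductorExponent_eq_two_of_five_le_of_isElliptic`). [cite: Silverman1994, IV.10.2 (b) and IV.10.4]
[cite: Cremona1997, Table 1 (curve 4563b1)] -/
theorem conductorExponent_curve4563b1_thirteen (v : HeightOneSpectrum ℤ) (hv : natGenerator v = 13) :
    curve4563b1.conductorExponent v = 2 :=
  conductorExponent_eq_two_of_five_le_of_isElliptic curve4563b1 v (by rw [hv]; norm_num)
    (hasAdditiveReductionAt_curve4563b1_thirteen v hv)

/-- **`v₁₃(N(4563b1)) = 2`** (`N = ∏ p^{f_p}`, tree `factorization_conductorNorm_primesEquiv_symm`).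
[cite: Silverman1994, IV.10.2 (b) and IV.10.4] [cite: Cremona1997, Table 1 (curve 4563b1)] -/
theorem factorization_conductorNorm_curve4563b1_thirteen : (curve4563b1.conductorNorm ℤ).factorization 13 = 2 := by
  rw [show (13 : ℕ) = ((⟨13, by norm_num⟩ : Nat.Primes) : ℕ) from rfl, factorization_conductorNorm_primesEquiv_symm]
  exact conductorExponent_curve4563b1_thirteen _
    (Literature.NumberTheory.EllipticCurves.Rat.natGenerator_primesEquiv_symm _)

/-- **`13 ∣ N(4563b1)`.** [cite: Cremona1997, Table 1 (curve 4563b1)] -/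
theorem thirteen_dvd_conductorNorm_curve4563b1 : 13 ∣ curve4563b1.conductorNorm ℤ :=
  Nat.dvd_of_factorization_pos (by rw [factorization_conductorNorm_curve4563b1_thirteen]; norm_num)

/-- **`N(4563b1) = 3^i · 13²` for some `i ≤ 3`** (p3's kernel bound `N ∣ 3³·13²` sharpened at `13`; Cremona:
`i = 3`, not needed). [cite: Silverman1994, IV.10.2 (b) and IV.10.4] [cite: Cremona1997, Table 1 (curve 4563b1)] -/
theorem conductorNorm_curve4563b1_eq_pow_mul : ∃ i ≤ 3, curve4563b1.conductorNorm ℤ = 3 ^ i * 13 ^ 2 := by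
  obtain ⟨y, z, hy, hz, hyz⟩ := Nat.dvd_mul.1 (show curve4563b1.conductorNorm ℤ ∣ 3 ^ 3 * 13 ^ 2 by
    simpa using conductorNorm_curve4563b1_dvd)
  obtain ⟨i, hi, rfl⟩ := (Nat.dvd_prime_pow Nat.prime_three).1 hy
  obtain ⟨k, hk, rfl⟩ := (Nat.dvd_prime_pow (by norm_num : Nat.Prime 13)).1 hz
  have h13 : Nat.Prime 13 := by norm_num
  have hfac := factorization_conductorNorm_curve4563b1_thirteen
  rw [← hyz, Nat.factorization_mul (pow_ne_zero _ (by norm_num)) (pow_ne_zero _ (by norm_num)),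
    Finsupp.add_apply, Nat.factorization_pow, Nat.factorization_pow, Finsupp.smul_apply, Finsupp.smul_apply,
    h13.factorization_self, Nat.factorization_eq_zero_of_not_dvd (by norm_num : ¬ 13 ∣ 3)] at hfac
  simp only [smul_eq_mul, mul_zero, mul_one, zero_add] at hfac
  exact ⟨i, hi, by rw [← hyz, hfac]⟩

/-- **The sign condition `χ_d(−N) = 1` for POSITIVE `d ≡ 1 (mod 12)` PRIME TO `13`** — without the `(d/13) = 1`
of p3's `sign_mul_jacobiSym_conductorNorm_curve4563b1`: `sgn(d)·(N/d) = (3/d)^i (13/d)² = (d/3)^i · 1 = 1`.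
[cite: KrizLi2019, Thm. 5.1 (2) condition "χ_d(−N) = 1"] -/
theorem sign_mul_jacobiSym_conductorNorm_curve4563b1_of_not_dvd {d : ℤ} (hd0 : 0 < d) (hd12 : d % 12 = 1)
    (h13 : ¬ (13 : ℤ) ∣ d) : Int.sign d * jacobiSym (curve4563b1.conductorNorm ℤ) d.natAbs = 1 := by
  rw [Int.sign_eq_one_of_pos hd0, one_mul]
  have hn : (d.natAbs : ℤ) = d := Int.natAbs_of_nonneg hd0.le
  have hn4 : d.natAbs % 4 = 1 := by omega
  have h3 : jacobiSym 3 d.natAbs = 1 := by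
    have hn3 : (d.natAbs : ℤ) % ((3 : ℕ) : ℤ) = 1 % ((3 : ℕ) : ℤ) := by
      change (d.natAbs : ℤ) % 3 = 1 % 3
      omega
    have hrec := jacobiSym.quadratic_reciprocity_one_mod_four' (a := 3) (b := d.natAbs) (by decide) hn4
    rw [Nat.cast_ofNat] at hrec
    rw [hrec, jacobiSym.mod_left, hn3, ← jacobiSym.mod_left, jacobiSym.one_left]
  have h13sq : jacobiSym 13 d.natAbs ^ 2 = 1 := by
    have h13' : ¬ 13 ∣ d.natAbs := fun h => h13 (by exact_mod_cast (Int.natCast_dvd.2 h : ((13 : ℕ) : ℤ) ∣ d))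
    have hgcd : (13 : ℤ).gcd (d.natAbs : ℤ) = 1 := by
      rw [Int.gcd_eq_natAbs, Int.natAbs_natCast]
      exact (Nat.Prime.coprime_iff_not_dvd (by norm_num)).2 h13'
    rcases jacobiSym.eq_one_or_neg_one hgcd with h | h <;> rw [h] <;> norm_num
  obtain ⟨i, -, hN⟩ := conductorNorm_curve4563b1_eq_pow_mul
  rw [hN, Nat.cast_mul, jacobiSym.mul_left, Nat.cast_pow, Nat.cast_pow, jacobiSym.pow_left,
    jacobiSym.pow_left, Nat.cast_ofNat, Nat.cast_ofNat, h3, h13sq, one_pow, one_mul]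

/-! ## §1 A member `d ∈ 𝒩(4563b1, K)` is prime to `13` (a silent prime does not divide `2N`, and `13 ∣ N`) -/

/-- **`13 ∤ d` for `d ∈ 𝒩(4563b1, K)`**, any `K`. [cite: KrizLi2019, Def. 4.1 (FMS) = arXiv Def. 3.1 ("ℓ ∤ 2N")] -/
theorem not_thirteen_dvd_of_inN_curve4563b1 {K : Type} [Field K] [NumberField K] {d : ℤ}
    (hd : KrizLi2019.InN curve4563b1 K d) : ¬ (13 : ℤ) ∣ d := fun h =>
  (hd.2.2 13 (by norm_num) (Int.natCast_dvd.1 (by exact_mod_cast h))).2.1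
    (dvd_mul_of_dvd_right thirteen_dvd_conductorNorm_curve4563b1 2)

/-! ## §2 The `4563b1` family over `K = ℚ(√D)` BY NAME, in the uniform shape (`d ∈ 𝒩`, `0 < d`, `d ≡ 1 (mod 12)`) -/

/-- **`4563b1` over `K = ℚ(√D)`, ANY certified `D`** (`D < 0`, `D ≡ 1 (mod 4)`, `|D|` square-free,
`(D/3) = (D/13) = 1`), displayed (★)-datum `hSD`: for `d ∈ 𝒩(4563b1, K)`, `d > 0`, `d ≡ 1 (mod 12)`, every `W′`
`ℚ`-isogenous to `4563b1^{(d)}` or `4563b1^{(D·d)}` lies in p3's generic family — ty2 g6's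
`isIsogenousToKrizLiTwistOfSmallCMBase_of_curve4563b1_sqrtField` WITHOUT its binder `(d/13) = 1` (§0–§1).
[cite: KrizLi2019, Thm. 5.1 (2), Def. 4.1, §6 Ex. 6.2] [cite: Marcus2018, Ch. 2 Thm. 1] -/
theorem isIsogenousToKrizLiTwistOfSmallCMBase_of_inN_curve4563b1_sqrtField {D : ℤ} [Fact (D < 0)]
    (hD4 : D % 4 = 1) (hsf : Squarefree D.natAbs) (h3 : jacobiSym D 3 = 1) (h13 : jacobiSym D 13 = 1)
    (hSD : HasKrizLiStarDatum curve4563b1 (sqrtField D)) {d : ℤ}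
    (hd : KrizLi2019.InN curve4563b1 (sqrtField D) d) (hd0 : 0 < d) (hd12 : d % 12 = 1)
    {W' : WeierstrassCurve ℚ}
    (hiso : IsIsogenous W' (curve4563b1.quadraticTwist (d : ℚ)) ∨
      IsIsogenous W' (curve4563b1.quadraticTwist ((D * d : ℤ) : ℚ))) :
    IsIsogenousToKrizLiTwistOfSmallCMBase W' := by
  haveI : Fact (2 : ℕ).Prime := ⟨Nat.prime_two⟩
  obtain ⟨hK, hdK⟩ := isImaginaryQuadratic_and_discr_sqrtField_of_squarefree_natAbs D hD4 hsf
  have hiso' : IsIsogenous W' (curve4563b1.quadraticTwist (d : ℚ)) ∨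
      IsIsogenous W' (curve4563b1.quadraticTwist ((d * NumberField.discr (sqrtField D) : ℤ) : ℚ)) := by
    rw [hdK, mul_comm]
    exact hiso
  exact ⟨curve4563b1, inferInstance, inferInstance, inferInstance, hasCM_curve4563b1, conductorNorm_curve4563b1_lt,
    one_le_mordellWeilRank_curve4563b1, twoTorsion_curve4563b1, odd_localTamagawaNumber_two_curve4563b1,
    sqrtField D, inferInstance, inferInstance, hK,
    satisfiesHeegnerHypothesis_curve4563b1_of_jacobiSym hK.1 (by rw [hdK]; exact h3) (by rw [hdK]; exact h13),
    hSD, d, hd, sign_mul_jacobiSym_conductorNorm_curve4563b1_of_not_dvd hd0 hd12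
      (not_thirteen_dvd_of_inN_curve4563b1 hd), hiso'⟩

/-- **`BSD(W′, 2)` on the Kriz–Li family of `4563b1` over `ℚ(√D)`, any certified `D`, uniform shape** (no
`(d/13)` binder). [cite: KrizLi2019, Thm. 5.1 (2) and Thm. 4.3] [cite: CreutzMiller2012, Thm. 1.1]
[cite: BurungaleFlach2024, Thm. 1.1 and Cor. 2] [cite: MilneADT2006, Thm. I.7.3] -/
theorem bsdp_two_of_isIsogenous_twist_of_inN_curve4563b1_sqrtField (hKL : KrizLi2019.thm112_bsdTwo_twist)
    (h33 : KrizLi2019.thm33_rank_twist) (hS31 : bsdTriple_of_analyticRank_le_one_of_conductor_lt)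
    (hBF : bsdTriple_of_hasCM_of_L_one_ne_zero) (hmod : hasEntireLFunction_rat)
    (hGZK : rank_eq_analyticRank_of_analyticRank_le_one) (hCassels : bsdRHS_eq_of_isIsogenous)
    {D : ℤ} [Fact (D < 0)] (hD4 : D % 4 = 1) (hsf : Squarefree D.natAbs) (h3 : jacobiSym D 3 = 1)
    (h13 : jacobiSym D 13 = 1) (hSD : HasKrizLiStarDatum curve4563b1 (sqrtField D)) {d : ℤ}
    (hd : KrizLi2019.InN curve4563b1 (sqrtField D) d) (hd0 : 0 < d) (hd12 : d % 12 = 1)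
    (W' : WeierstrassCurve ℚ) [W'.IsElliptic] [W'.IsGloballyMinimal]
    (hiso : IsIsogenous W' (curve4563b1.quadraticTwist (d : ℚ)) ∨
      IsIsogenous W' (curve4563b1.quadraticTwist ((D * d : ℤ) : ℚ))) : BSDp W' 2 :=
  bsdp_two_of_isIsogenousToKrizLiTwistOfSmallCMBase hKL h33 hS31 hBF hmod hGZK hCassels W'
    (isIsogenousToKrizLiTwistOfSmallCMBase_of_inN_curve4563b1_sqrtField hD4 hsf h3 h13 hSD hd hd0 hd12 hiso)

/-- **`4563b1^{(d)}` ON THE NOSE over `ℚ(√D)`, uniform shape**: for `d ∈ 𝒩(4563b1, ℚ(√D))`, `d > 0`,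
`d ≡ 1 (mod 12)`, the twist model `E_k : y² + y = x³ + k`, `4k + 1 = 13²·d³`, is globally minimal with
`ord_{s=1} L(E_k, s) = 1 ∧ BSD(E_k, 2)` — ty2 g5's `analyticRank_eq_one_and_bsdp_two_twistModel_curve4563b1`
with its binders `hsign`, `13 ∤ d` discharged by §0–§1. [cite: KrizLi2019, Thm. 5.1 (2), Thm. 4.3, Def. 4.1]
[cite: CreutzMiller2012, Thm. 1.1] [cite: BurungaleFlach2024, Thm. 1.1 and Cor. 2] [cite: MilneADT2006, Thm. I.7.3]
[cite: SilvermanAEC2009, VII.1 Remark 1.1] -/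
theorem analyticRank_eq_one_and_bsdp_two_twistModel_of_inN_curve4563b1_sqrtField
    (hKL : KrizLi2019.thm112_bsdTwo_twist) (h33 : KrizLi2019.thm33_rank_twist)
    (hS31 : bsdTriple_of_analyticRank_le_one_of_conductor_lt) (hBF : bsdTriple_of_hasCM_of_L_one_ne_zero)
    (hmod : hasEntireLFunction_rat) (hGZK : rank_eq_analyticRank_of_analyticRank_le_one)
    (hCassels : bsdRHS_eq_of_isIsogenous) {D : ℤ} [Fact (D < 0)] (hD4 : D % 4 = 1)
    (hsf : Squarefree D.natAbs) (h3 : jacobiSym D 3 = 1) (h13 : jacobiSym D 13 = 1)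
    (hSD : HasKrizLiStarDatum curve4563b1 (sqrtField D)) {d k : ℤ} (hk : 4 * k + 1 = d ^ 3 * 169)
    (hd : KrizLi2019.InN curve4563b1 (sqrtField D) d) (hd0 : 0 < d) (hd12 : d % 12 = 1) :
    ∃ _ : (cubicA₃ k).IsGloballyMinimal, (cubicA₃ k).analyticRank = 1 ∧ BSDp (cubicA₃ k) 2 := by
  obtain ⟨hK, hdK⟩ := isImaginaryQuadratic_and_discr_sqrtField_of_squarefree_natAbs D hD4 hsf
  have h13d : ¬ (13 : ℤ) ∣ d := not_thirteen_dvd_of_inN_curve4563b1 hd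
  exact analyticRank_eq_one_and_bsdp_two_twistModel_curve4563b1 hKL h33 hS31 hBF hmod hGZK hCassels
    (sqrtField D) hK
    (satisfiesHeegnerHypothesis_curve4563b1_of_jacobiSym hK.1 (by rw [hdK]; exact h3) (by rw [hdK]; exact h13))
    hSD hk hd (sign_mul_jacobiSym_conductorNorm_curve4563b1_of_not_dvd hd0 hd12 h13d) hd12 h13d

/-! ## §3 Every CERTIFIED record at base data `(−23, −2704, [2,3,13])` is a member: `BSD(W′, 2)` for the
isogeny classes of `4563b1^{(d)}`, `4563b1^{(−23d)}`, and the record's model `E_k` on the nose -/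

/-- **A certified `4563b1` record decoded to `d ∈ 𝒩(4563b1, ℚ(√−23))`** (ty2 g6's `inN_curve4563b1_of_discr_eq`
on the kernel-rechecked silent primes: `ℓ ∉ {2,3,13}`, `(−23/ℓ) = 1`, `#{x ∈ 𝔽_ℓ : x³ = −2704}` even).
[cite: KrizLi2019, Def. 4.1 (FMS) = arXiv Def. 3.1] -/
theorem inN_curve4563b1_of_check {r : KLRecord} (h : r.check = true) (hD : r.fieldDisc = -23)
    (hc : r.cubeConst = -2704) (hb : r.badPrimes = [2, 3, 13]) :
    KrizLi2019.InN curve4563b1 (sqrtField (-23)) (r.d : ℤ) ∧ (0 : ℤ) < (r.d : ℤ) ∧ (r.d : ℤ) % 12 = 1 := by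
  obtain ⟨hd0, hd12, hd4, hsq, hP⟩ := klExplicit_of_check h hD hc hb (by simp)
  refine ⟨inN_curve4563b1_of_discr_eq (sqrtField.finrank_eq_two (-23))
    isImaginaryQuadratic_and_discr_sqrtField_neg_twentyThree.2 hd4 hsq fun ℓ hℓ hℓd => ?_, hd0, hd12⟩
  obtain ⟨hbad, -, hj, hev⟩ := hP ℓ hℓ hℓd
  refine ⟨fun e => hbad (by simp [e]), fun e => hbad (by simp [e]), fun e => hbad (by simp [e]), hj, ?_⟩
  have e : ((-2704 : ℤ) : ZMod ℓ) = -2704 := by push_cast; norm_num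
  rw [← e]; exact hev

/-- **Base `4563b1` over `K = ℚ(√−23)`** ((★) CERTIFIED, displayed as `hSD`): for every record of a certified
list with base data `(−23, −2704, [2,3,13])`, `BSD(W′, 2)` for every globally minimal `W′` `ℚ`-isogenous to
`4563b1^{(d)}` or `4563b1^{(−23d)}`. [cite: KrizLi2019, Thm. 5.1 (2), Def. 4.1 and §6 Ex. 6.2]
[cite: CreutzMiller2012, Thm. 1.1] [cite: BurungaleFlach2024, Thm. 1.1 and Cor. 2] [cite: MilneADT2006, Thm. I.7.3] -/
theorem bsdp_two_of_klCertified_4563b1 (hKL : KrizLi2019.thm112_bsdTwo_twist)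
    (h33 : KrizLi2019.thm33_rank_twist) (hS31 : bsdTriple_of_analyticRank_le_one_of_conductor_lt)
    (hBF : bsdTriple_of_hasCM_of_L_one_ne_zero) (hmod : hasEntireLFunction_rat)
    (hGZK : rank_eq_analyticRank_of_analyticRank_le_one) (hCassels : bsdRHS_eq_of_isIsogenous)
    (hSD : HasKrizLiStarDatum curve4563b1 (sqrtField (-23)))
    {rs : List KLRecord} (h : KLCertified rs) :
    ∀ r ∈ rs, r.fieldDisc = -23 → r.cubeConst = -2704 → r.badPrimes = [2, 3, 13] →
      ∀ (W' : WeierstrassCurve ℚ) [W'.IsElliptic] [W'.IsGloballyMinimal],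
        (IsIsogenous W' (curve4563b1.quadraticTwist ((r.d : ℤ) : ℚ)) ∨
          IsIsogenous W' (curve4563b1.quadraticTwist ((-23 * (r.d : ℤ) : ℤ) : ℚ))) → BSDp W' 2 := by
  intro r hr hD hc hb W' _ _ hiso
  obtain ⟨hIn, hd0, hd12⟩ := inN_curve4563b1_of_check (h.check_of_mem hr) hD hc hb
  exact bsdp_two_of_isIsogenous_twist_of_inN_curve4563b1_sqrtField hKL h33 hS31 hBF hmod hGZK hCassels
    (D := -23) (by norm_num) (by exact (Nat.prime_iff.1 (by norm_num)).squarefree) (by norm_num) (by norm_num) hSD hIn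
    hd0 hd12 W' hiso

/-- **Base `4563b1`, the record's curve ON THE NOSE**: for every record of a certified list with base data
`(−23, −2704, [2,3,13])` and any `k` with `4k + 1 = 13²·d³` (the record's model `[0,0,1,0,k]`, checked per list
in the display file), `E_k = y² + y = x³ + k` is globally minimal with `ord_{s=1} L(E_k, s) = 1 ∧ BSD(E_k, 2)`.
[cite: KrizLi2019, Thm. 5.1 (2), Thm. 4.3, Def. 4.1] [cite: CreutzMiller2012, Thm. 1.1]
[cite: BurungaleFlach2024, Thm. 1.1 and Cor. 2] [cite: MilneADT2006, Thm. I.7.3] [cite: SilvermanAEC2009, VII.1 Remark 1.1] -/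
theorem analyticRank_eq_one_and_bsdp_two_twistModel_of_klCertified_4563b1
    (hKL : KrizLi2019.thm112_bsdTwo_twist) (h33 : KrizLi2019.thm33_rank_twist)
    (hS31 : bsdTriple_of_analyticRank_le_one_of_conductor_lt) (hBF : bsdTriple_of_hasCM_of_L_one_ne_zero)
    (hmod : hasEntireLFunction_rat) (hGZK : rank_eq_analyticRank_of_analyticRank_le_one)
    (hCassels : bsdRHS_eq_of_isIsogenous) (hSD : HasKrizLiStarDatum curve4563b1 (sqrtField (-23)))
    {rs : List KLRecord} (h : KLCertified rs) :
    ∀ r ∈ rs, r.fieldDisc = -23 → r.cubeConst = -2704 → r.badPrimes = [2, 3, 13] →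
      ∀ k : ℤ, 4 * k + 1 = (r.d : ℤ) ^ 3 * 169 →
        ∃ _ : (cubicA₃ k).IsGloballyMinimal, (cubicA₃ k).analyticRank = 1 ∧ BSDp (cubicA₃ k) 2 := by
  intro r hr hD hc hb k hk
  obtain ⟨hIn, hd0, hd12⟩ := inN_curve4563b1_of_check (h.check_of_mem hr) hD hc hb
  exact analyticRank_eq_one_and_bsdp_two_twistModel_of_inN_curve4563b1_sqrtField hKL h33 hS31 hBF hmod hGZK
    hCassels (D := -23) (by norm_num) (by exact (Nat.prime_iff.1 (by norm_num)).squarefree) (by norm_num) (by norm_num)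
    hSD hk hIn hd0 hd12

end Summit.BirchSwinnertonDyer.Rank1Residual.P2

end
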